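import Summits.HodgeConjecture.HodgeConjecture.Theorems.HeckePrymWeilHeckePrymAnchorsOfCMAnchoredFamily
import HarnessLib

/-!
# Line `jacobian-hodge-locus` for crux `HeckePrymAnchors` (item stmt-HodgeConjecture-14496, route HeckePrymWeil)

Crux-strategist ALTERNATIVE line (planner-cstrat-stmt-HodgeConjecture-14496-s2-0, 2026-08-17; `--alt`,
does not touch the lead's `Lines/Sketch.lean`). Card: `Lines/jacobian-hodge-locus.md`.

Statements are INLINED (no local definitions): the two stub types below are [U_loc] and the density
lemma; `localWeilFamily_of_periodConstruction` and `cmAnchoredFamily_of_localWeilFamily` are the two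
kernel-checked sandwich certificates [U] ⟹ [U_loc] and [U_loc] ∧ density ⟹ [U_alg].

IDEA (transfer with dictionary: the universal CURVE replaces the universal ABELIAN VARIETY). The live
line is blocked on item 16866 = Deligne's GLOBAL Weil family over the arithmetic quotient `Γ\X⁺`
(Baily–Borel + Borel + uniformisation of the abstract `X`, none in the tree). This line cuts the
crux at the weakest typed interface through which ANY deformation-theoretic road delivers it:

* STUB 1 [U_loc] (`stub_localWeilFamily`) — an algebraic smooth projective `√-p`-family through the balanced
  `(X, Φ)` (clauses (1)–(8) of the landed residual [U_alg] of
  `heckePrymAnchors_of_cmAnchoredFamily`, p144675) whose period map is LOCALLY SURJECTIVE AT SOME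
  FIBRE `s⋆`: every Weil complex structure of the rational Weil datum of the chart `(Y, Ψ)` at `s⋆`
  whose matrix lies in a fixed OPEN set `O` (containing one such) is the period point of a fibre.
  Strictly weaker than Deligne's period construction [U] (surjectivity for ALL `J`), so [U] ⟹ it;
  but it is also the output of two LOCAL roads that need no Baily–Borel / Borel / `Γ`-quotient /
  uniformisation: [V] an algebraised versal PEL deformation (Artin) + local Torelli, and — the road
  this line is named after — [C] the JACOBIAN HODGE-LOCUS FAMILY: put a complete-intersection curve
  `C₁ ⊂ X`, so `J(C₁) ↠ X`; move `C₁` in the tree's NAMED fine-moduli cover of curves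
  (`ModuliOfCurves.nonempty_stableCurvesModuliCover`, Looijenga / Boggi–Pikaart); the locus where the
  two Hodge classes on `J × J` cutting out `ker (J ↠ X)` and `Φ` stay Hodge is ALGEBRAIC by
  Cattani–Deligne–Kaplan (`Barriers…CattaniDeligneKaplan1995_hodgeLocus_algebraicFor`); over (a
  resolution of a finite étale cover of) its component the classes are endomorphisms (Lefschetz
  `(1,1)` on `J × J` + Grothendieck–Deligne extension), the quotient abelian scheme `𝒥/𝒦` has fibre
  EXACTLY `X` and carries `√-p`; projective over an affine base by the tree's NAMED Raynaud fact
  (`Motives.raynaud1970_abelianScheme_section_projective`); every first-order PEL deformation of `X`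
  moves `C₁` along (complete intersections of sections of the deformed polarisation; `H¹(X, L) = 0`),
  so the period map restricted to the CI germ is a submersion, hence (Sard + open mapping for
  submersions, Mathlib) the period map of the family is OPEN at some point `s⋆` — which is all
  [U_loc] asks.
* STUB 2 (`stub_rationalDiagonalDense`) — the rational diagonal points `J_R` (van Geemen 5.4–5.8; the point used
  by c34's `cm_projector_of_periodPoint`) are DENSE in `X⁺(D)`: `K = ℚ(√-p)` is dense in `ℂ` and
  `X⁺` is open in the Grassmannian of `K ⊗ ℂ`-planes. M-sized, provable now, shared by roads [V], [C].
* GLUE (proved below, no sorry): stub 1 → stub 2 → [U_alg] — a rational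
  diagonal point inside `O` is the period point of a fibre `(Y', Ψ')`, which then carries the CM
  projector (`cm_projector_of_periodPoint`), i.e. clause (9) of [U_alg]; and
  `HeckePrymAnchors_of := heckePrymAnchors_of_cmAnchoredFamily (glue …)` concludes the crux BY NAME.

Disproof used: Disproof.lean rev 4 has no `_false_without_` theorem; §2/§3′
(`anchored_of_mem_algebraicClasses`, `heckePrymAnchors_of_hodgeWeilLadder'`) say a genuine
deformation of the abstract `A` is needed — honoured: [U_loc] deforms `X` itself (period-open), not a
partner. Negative/ConstantFamilyBound (p98656) is about constant families — not an instance here.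
-/

noncomputable section

set_option linter.dupNamespace false

open CategoryTheory AlgebraicGeometry Limits MonoidalCategory CartesianMonoidalCategory
open Literature.AlgebraicTopology.SingularHomology
open scoped TensorProduct

namespace Summit.HodgeConjecture.HodgeConjecture.Cruxes.HeckePrymAnchors.JacobianHodgeLocus

open Literature.AlgebraicGeometry Literature.AlgebraicGeometry.Motives Literature.AlgebraicGeometry.HodgeTheory
open Summit.HodgeConjecture.HodgeConjecture.Theses.HeckePrymWeil
open Summit.HodgeConjecture.HodgeConjecture.Theorems.HeckePrymWeilLine

/-! ## The stubs (the ONLY sorries of this file) -/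

/-- STUB 1 (hardest) — **[U_loc] LOCAL WEIL FAMILY through a balanced `(X, Φ)`.** For `p ≡ 3 (4)`
prime `≥ 7`, `k ≥ 1` and every complex abelian `2k`-fold `(X, Φ)`, `Φ ≫ Φ = -p`, of balanced Weil
type (`dim (V_{i√p} ∩ H^{1,0}) = k`): a smooth projective family `f : 𝒳 → S` of relative dimension
`2k`, closed in `ℙᴺ × S`, over a smooth irreducible quasi-projective base, a global endomorphism `g`
over `S` (the `√-p`), abelian Weil-type charts at every complex point, a chart `e : X ≅ 𝒳_{s₁}`
intertwining `Φ` and `g`, integral level-`n' ≥ 3` monodromy at `s₁` — clauses (1)–(8) of [U_alg]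
VERBATIM — and LOCAL PERIOD SURJECTIVITY AT SOME FIBRE: a point `s⋆`, a chart `(Y, Ψ) ≅ 𝒳_{s⋆}`
with the data of its rational Weil datum `D⋆ = weilDatumOfKsymm …` (van Geemen 5.3), a `ℂ`-basis
`bc` of `D⋆.Cx` and an OPEN set `O` of matrices containing the matrix of at least one Weil complex
structure of `D⋆`, such that every Weil complex structure `J` of `D⋆` with `[J]_{bc} ∈ O` is the
period point of a fibre: a chart `(Y', Ψ') ≅ 𝒳_s` and a `K`-linear `β : H¹(Y; ℚ) ≃ H¹(Y'; ℚ)`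
carrying `V^{1,0}(J)` into `H^{1,0}(Y')` (clause (4) of Deligne's period construction [U],
restricted to `O`). TRUE: implied by [U] (`localWeilFamily_of_periodConstruction` below: `s⋆ = s₁`,
`O = univ`). Delivered WITHOUT Baily–Borel / Borel / `Γ`-quotients / uniformisation of `X` by road
[C] (Jacobian Hodge-locus family: the tree's NAMED fine-moduli cover of curves
`ModuliOfCurves.nonempty_stableCurvesModuliCover` + Cattani–Deligne–Kaplan
`CattaniDeligneKaplan1995_hodgeLocus_algebraicFor` + Lefschetz `(1,1)` on `J × J` and
Grothendieck–Deligne extension of endomorphisms + quotient abelian scheme `𝒥/𝒦` with fibre EXACTLY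
`X` + level cover + `Motives.raynaud1970_abelianScheme_section_projective` + KS-surjectivity along the
complete-intersection germ + Sard/open mapping for submersions) or by road [V] (Artin-algebraised
versal PEL deformation + local Torelli); see `Lines/jacobian-hodge-locus.md`.
[cite: Deligne1982HodgeCycles, proof of Thm. 4.8 (pp. 48–51)] [cite: vanGeemen1994HodgeAV, 5.3–5.8]
[cite: CattaniDeligneKaplan1995, Thm. 1.1 / Cor. 1.2] [cite: Artin1969, Thm. 1.6] -/
theorem stub_localWeilFamily :
    ∀ p : ℕ, p.Prime → p % 4 = 3 → 7 ≤ p → ∀ (k : ℕ), 1 ≤ k → ∀ (X : AbelianVariety ℂ) (Φ : X ⟶ X)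
    (hX : X.dim = 2 * k), Φ ≫ Φ = -((p : ℤ) • 𝟙 X) →
    Module.finrank ℂ ↥(Module.End.eigenspace (complexBetti.map Φ.hom.hom.hom 1).hom
    (Complex.I * (Real.sqrt p : ℂ)) ⊓ hodgeOneZero (Motives.isSmoothProjective_of_dim_eq' hX)) = k →
    ∃ (𝒳 S : SchemeOver ℂ) (f : 𝒳 ⟶ S) (g : 𝒳 ⟶ 𝒳) (s₁ : ComplexPoints S) (e : X.X ≅ fiberOver f s₁),
    IsSmoothProjectiveFamily f (2 * k) ∧
    (∃ (N : ℕ) (ι : 𝒳 ⟶ projectiveSpace N ℂ ⊗ S), IsClosedImmersion ι.left ∧ ι ≫ snd (projectiveSpace N ℂ) S = f) ∧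
    IrreducibleSpace S.left ∧ AlgebraicGeometry.Smooth S.hom ∧ IsQuasiProjectiveOver S ∧ g ≫ f = f ∧
    (∀ s : ComplexPoints S, ∃ (A' : AbelianVariety ℂ) (φ' : A' ⟶ A') (e' : A'.X ≅ fiberOver f s),
    A'.dim = 2 * k ∧ φ' ≫ φ' = -((p : ℤ) • 𝟙 A') ∧
    (e'.hom ≫ fiberι f s) ≫ g = φ'.hom.hom.hom ≫ (e'.hom ≫ fiberι f s)) ∧
    (e.hom ≫ fiberι f s₁) ≫ g = Φ.hom.hom.hom ≫ (e.hom ≫ fiberι f s₁) ∧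
    (∃ (ιb : Type) (_ : Fintype ιb) (_ : DecidableEq ιb) (b : Module.Basis ιb ℂ (complexBetti (fiberOver f s₁) 1))
    (Jℤ : Matrix ιb ιb ℤ) (n' : ℕ), 3 ≤ n' ∧
    (∀ g₁ : fiberOver f s₁ ⟶ fiberOver f s₁, g₁ ≫ fiberι f s₁ = fiberι f s₁ ≫ g →
    LinearMap.toMatrix b b (complexBetti.map g₁ 1).hom = Jℤ.map (Int.castRingHom ℂ)) ∧
    ∀ (hU : IsCohomologicallyLocallyTrivialOn f (Set.univ : Set (ComplexPoints S)))
    (γ : Path.Homotopic.Quotient (⟨s₁, Set.mem_univ s₁⟩ : (Set.univ : Set (ComplexPoints S))) ⟨s₁, Set.mem_univ s₁⟩),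
    ∃ Dℤ : Matrix ιb ιb ℤ, LinearMap.toMatrix b b (transportLinear f 1 hU γ :) = (1 + (n' : ℤ) • Dℤ).map (Int.castRingHom ℂ)) ∧
    ∃ (sStar : ComplexPoints S) (Y : AbelianVariety ℂ) (Ψ : Y ⟶ Y) (ε : Y.X ≅ fiberOver f sStar)
    (m : ℕ) (hm : 1 ≤ m) (hYm : Y.dim = m + 1) (hp0 : 0 < p) (hΨ : Ψ ≫ Ψ = -(p • 𝟙 Y))
    (eY : ProjectiveEmbedding Y.X) (a : complexBetti (projectiveSpace eY.n ℂ) 2)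
    (ha : IsRationalClass a) (ha0 : a ≠ 0) (ω : complexBetti Y.X (2 + 2 * m)) (hω : IsRationalClass ω) (hω0 : ω ≠ 0)
    (ιc : Type) (_ : Fintype ιc) (_ : DecidableEq ιc)
    (bc : Module.Basis ιc ℂ (weilDatumOfKsymm hm hYm hp0 hΨ eY ha ha0 hω hω0).Cx)
    (O : Set (Matrix ιc ιc ℂ)),
    Y.dim = 2 * k ∧ (ε.hom ≫ fiberι f sStar) ≫ g = Ψ.hom.hom.hom ≫ (ε.hom ≫ fiberι f sStar) ∧ IsOpen O ∧
    (∃ J₀ : (weilDatumOfKsymm hm hYm hp0 hΨ eY ha ha0 hω hω0).Cx →ₗ[ℂ] (weilDatumOfKsymm hm hYm hp0 hΨ eY ha ha0 hω hω0).Cx,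
    Motives.IsWeilComplexStructure (weilDatumOfKsymm hm hYm hp0 hΨ eY ha ha0 hω hω0).hForm J₀ ∧
    LinearMap.toMatrix bc bc J₀ ∈ O) ∧
    ∀ (J : (weilDatumOfKsymm hm hYm hp0 hΨ eY ha ha0 hω hω0).Cx →ₗ[ℂ] (weilDatumOfKsymm hm hYm hp0 hΨ eY ha ha0 hω hω0).Cx)
    (hW : Motives.IsWeilComplexStructure (weilDatumOfKsymm hm hYm hp0 hΨ eY ha ha0 hω hω0).hForm J),
    LinearMap.toMatrix bc bc J ∈ O →
    ∃ (s : ComplexPoints S) (Y' : AbelianVariety ℂ) (Ψ' : Y' ⟶ Y') (ε' : Y'.X ≅ fiberOver f s)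
    (β : bettiCohomology Y.X 1 ≃ₗ[ℚ] bettiCohomology Y'.X 1),
    Y'.dim = 2 * k ∧ Ψ' ≫ Ψ' = -((p : ℤ) • 𝟙 Y') ∧
    (ε'.hom ≫ fiberι f s) ≫ g = Ψ'.hom.hom.hom ≫ (ε'.hom ≫ fiberι f s) ∧
    (∀ x, β (bettiCohomology.map Ψ.hom.hom.hom 1 x) = bettiCohomology.map Ψ'.hom.hom.hom 1 (β x)) ∧
    ∀ x ∈ ((weilDatumOfKsymm hm hYm hp0 hΨ eY ha ha0 hω hω0).hodgeStructure J hW.sq).piece 1 0,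
    IsOfHodgeType (2 * k) Y'.X 1 1 0
    (Motives.ofRatClassBaseChange (ComplexPoints Y'.X) 1 (β.toLinearMap.baseChange ℂ x)) := by
  sorry

/-- STUB 2 — **rational diagonal points are DENSE in the period domain of a Weil datum.** For every
rational Weil datum `D` on a finite-dimensional `V` (van Geemen 5.3), every `ℂ`-basis `bc` of `D.Cx`
and every open set `O` of matrices containing the matrix of SOME Weil complex structure of `D`, there
is a rational splitting `V = P ⊕ N` into `α`-stable subspaces with its diagonal operator `R`
(`= α` on `P`, `-α` on `N`) whose complex structure `J_R = c·R_ℂ` is a Weil complex structure with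
`ker(J_R - i) = P_ℂ`, `ker(J_R + i) = N_ℂ` (exactly the data consumed by `cm_projector_of_periodPoint`)
AND `[J_R]_{bc} ∈ O`. Proof sketch (M-sized, provable now): `D.Cx = V ⊗_K ℂ` for `K = ℚ(√-d)`;
`X⁺(D)` is open in the Grassmannian of `k`-planes (`W₊ = ker (J - i)`, positive for `H`); `K`-rational
planes `P ⊗_K ℂ` are dense because `K` is dense in `ℂ`; positivity is open; `N := P^{⊥_E}`; `J_W`
depends continuously on `W` (`Motives/WeilTypePeriodDomainTopology`, angular operator).
[cite: vanGeemen1994HodgeAV, 5.4–5.8] [cite: Deligne1982HodgeCycles, proof of Thm. 4.8, p. 49 ("open connected")] -/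
theorem stub_rationalDiagonalDense :
    ∀ (V : Type) [AddCommGroup V] [Module ℚ V] [FiniteDimensional ℚ V] (D : Motives.WeilDatum V)
    (ιc : Type) [Fintype ιc] [DecidableEq ιc] (bc : Module.Basis ιc ℂ D.Cx) (O : Set (Matrix ιc ιc ℂ)),
    IsOpen O →
    (∃ J₀ : D.Cx →ₗ[ℂ] D.Cx, Motives.IsWeilComplexStructure D.hForm J₀ ∧ LinearMap.toMatrix bc bc J₀ ∈ O) →
    ∃ (P N : Submodule ℚ V) (R : V →ₗ[ℚ] V) (hRα : ∀ x, R (D.α x) = D.α (R x))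
    (hPα : ∀ u ∈ P, D.α u ∈ P) (hNα : ∀ u ∈ N, D.α u ∈ N),
    IsCompl P N ∧
    Motives.IsWeilComplexStructure D.hForm ((D.c : ℂ) • D.cxMap R hRα) ∧
    Module.End.eigenspace ((D.c : ℂ) • D.cxMap R hRα) Complex.I = D.cxSpan hPα ∧
    Module.End.eigenspace ((D.c : ℂ) • D.cxMap R hRα) (-Complex.I) = D.cxSpan hNα ∧
    LinearMap.toMatrix bc bc ((D.c : ℂ) • D.cxMap R hRα) ∈ O := by
  sorry

/-! ## Glue (proved): [U_loc] ∧ density ⟹ [U_alg]; [U] ⟹ [U_loc]; the crux by name -/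

set_option maxHeartbeats 800000 in
/-- **[U_loc] + density ⟹ [U_alg]** (the hypothesis of the landed `heckePrymAnchors_of_cmAnchoredFamily`,
p144675, verbatim): the rational diagonal point found by the density lemma inside the open set `O` of
[U_loc] is the period point of a fibre `(Y', Ψ') ≅ 𝒳_{s₀}`, which therefore carries the CM projector
of `cm_projector_of_periodPoint` (c34) — clause (9) of [U_alg]; clauses (1)–(8) pass through.
[cite: Deligne1982HodgeCycles, proof of Thm. 4.8 (pp. 49–51)] [cite: vanGeemen1994HodgeAV, 5.4–5.7] -/
theorem cmAnchoredFamily_of_localWeilFamily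
    (hL : (∀ p : ℕ, p.Prime → p % 4 = 3 → 7 ≤ p → ∀ (k : ℕ), 1 ≤ k → ∀ (X : AbelianVariety ℂ) (Φ : X ⟶ X)
    (hX : X.dim = 2 * k), Φ ≫ Φ = -((p : ℤ) • 𝟙 X) →
    Module.finrank ℂ ↥(Module.End.eigenspace (complexBetti.map Φ.hom.hom.hom 1).hom
      (Complex.I * (Real.sqrt p : ℂ)) ⊓ hodgeOneZero (Motives.isSmoothProjective_of_dim_eq' hX)) = k →
    ∃ (𝒳 S : SchemeOver ℂ) (f : 𝒳 ⟶ S) (g : 𝒳 ⟶ 𝒳) (s₁ : ComplexPoints S) (e : X.X ≅ fiberOver f s₁),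
      IsSmoothProjectiveFamily f (2 * k) ∧
      (∃ (N : ℕ) (ι : 𝒳 ⟶ projectiveSpace N ℂ ⊗ S), IsClosedImmersion ι.left ∧ ι ≫ snd (projectiveSpace N ℂ) S = f) ∧
      IrreducibleSpace S.left ∧ AlgebraicGeometry.Smooth S.hom ∧ IsQuasiProjectiveOver S ∧ g ≫ f = f ∧
      (∀ s : ComplexPoints S, ∃ (A' : AbelianVariety ℂ) (φ' : A' ⟶ A') (e' : A'.X ≅ fiberOver f s),
        A'.dim = 2 * k ∧ φ' ≫ φ' = -((p : ℤ) • 𝟙 A') ∧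
        (e'.hom ≫ fiberι f s) ≫ g = φ'.hom.hom.hom ≫ (e'.hom ≫ fiberι f s)) ∧
      (e.hom ≫ fiberι f s₁) ≫ g = Φ.hom.hom.hom ≫ (e.hom ≫ fiberι f s₁) ∧
      (∃ (ιb : Type) (_ : Fintype ιb) (_ : DecidableEq ιb) (b : Module.Basis ιb ℂ (complexBetti (fiberOver f s₁) 1))
          (Jℤ : Matrix ιb ιb ℤ) (n' : ℕ), 3 ≤ n' ∧
        (∀ g₁ : fiberOver f s₁ ⟶ fiberOver f s₁, g₁ ≫ fiberι f s₁ = fiberι f s₁ ≫ g →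
          LinearMap.toMatrix b b (complexBetti.map g₁ 1).hom = Jℤ.map (Int.castRingHom ℂ)) ∧
        ∀ (hU : IsCohomologicallyLocallyTrivialOn f (Set.univ : Set (ComplexPoints S)))
          (γ : Path.Homotopic.Quotient (⟨s₁, Set.mem_univ s₁⟩ : (Set.univ : Set (ComplexPoints S))) ⟨s₁, Set.mem_univ s₁⟩),
          ∃ Dℤ : Matrix ιb ιb ℤ, LinearMap.toMatrix b b (transportLinear f 1 hU γ :) = (1 + (n' : ℤ) • Dℤ).map (Int.castRingHom ℂ)) ∧
      ∃ (sStar : ComplexPoints S) (Y : AbelianVariety ℂ) (Ψ : Y ⟶ Y) (ε : Y.X ≅ fiberOver f sStar)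
        (m : ℕ) (hm : 1 ≤ m) (hYm : Y.dim = m + 1) (hp0 : 0 < p) (hΨ : Ψ ≫ Ψ = -(p • 𝟙 Y))
        (eY : ProjectiveEmbedding Y.X) (a : complexBetti (projectiveSpace eY.n ℂ) 2)
        (ha : IsRationalClass a) (ha0 : a ≠ 0) (ω : complexBetti Y.X (2 + 2 * m)) (hω : IsRationalClass ω) (hω0 : ω ≠ 0)
        (ιc : Type) (_ : Fintype ιc) (_ : DecidableEq ιc)
        (bc : Module.Basis ιc ℂ (weilDatumOfKsymm hm hYm hp0 hΨ eY ha ha0 hω hω0).Cx)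
        (O : Set (Matrix ιc ιc ℂ)),
        Y.dim = 2 * k ∧ (ε.hom ≫ fiberι f sStar) ≫ g = Ψ.hom.hom.hom ≫ (ε.hom ≫ fiberι f sStar) ∧ IsOpen O ∧
        (∃ J₀ : (weilDatumOfKsymm hm hYm hp0 hΨ eY ha ha0 hω hω0).Cx →ₗ[ℂ] (weilDatumOfKsymm hm hYm hp0 hΨ eY ha ha0 hω hω0).Cx,
          Motives.IsWeilComplexStructure (weilDatumOfKsymm hm hYm hp0 hΨ eY ha ha0 hω hω0).hForm J₀ ∧
          LinearMap.toMatrix bc bc J₀ ∈ O) ∧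
        ∀ (J : (weilDatumOfKsymm hm hYm hp0 hΨ eY ha ha0 hω hω0).Cx →ₗ[ℂ] (weilDatumOfKsymm hm hYm hp0 hΨ eY ha ha0 hω hω0).Cx)
          (hW : Motives.IsWeilComplexStructure (weilDatumOfKsymm hm hYm hp0 hΨ eY ha ha0 hω hω0).hForm J),
          LinearMap.toMatrix bc bc J ∈ O →
          ∃ (s : ComplexPoints S) (Y' : AbelianVariety ℂ) (Ψ' : Y' ⟶ Y') (ε' : Y'.X ≅ fiberOver f s)
            (β : bettiCohomology Y.X 1 ≃ₗ[ℚ] bettiCohomology Y'.X 1),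
            Y'.dim = 2 * k ∧ Ψ' ≫ Ψ' = -((p : ℤ) • 𝟙 Y') ∧
            (ε'.hom ≫ fiberι f s) ≫ g = Ψ'.hom.hom.hom ≫ (ε'.hom ≫ fiberι f s) ∧
            (∀ x, β (bettiCohomology.map Ψ.hom.hom.hom 1 x) = bettiCohomology.map Ψ'.hom.hom.hom 1 (β x)) ∧
            ∀ x ∈ ((weilDatumOfKsymm hm hYm hp0 hΨ eY ha ha0 hω hω0).hodgeStructure J hW.sq).piece 1 0,
              IsOfHodgeType (2 * k) Y'.X 1 1 0
                (Motives.ofRatClassBaseChange (ComplexPoints Y'.X) 1 (β.toLinearMap.baseChange ℂ x))))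
    (hD : (∀ (V : Type) [AddCommGroup V] [Module ℚ V] [FiniteDimensional ℚ V] (D : Motives.WeilDatum V)
    (ιc : Type) [Fintype ιc] [DecidableEq ιc] (bc : Module.Basis ιc ℂ D.Cx) (O : Set (Matrix ιc ιc ℂ)),
    IsOpen O →
    (∃ J₀ : D.Cx →ₗ[ℂ] D.Cx, Motives.IsWeilComplexStructure D.hForm J₀ ∧ LinearMap.toMatrix bc bc J₀ ∈ O) →
    ∃ (P N : Submodule ℚ V) (R : V →ₗ[ℚ] V) (hRα : ∀ x, R (D.α x) = D.α (R x))
      (hPα : ∀ u ∈ P, D.α u ∈ P) (hNα : ∀ u ∈ N, D.α u ∈ N),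
      IsCompl P N ∧
      Motives.IsWeilComplexStructure D.hForm ((D.c : ℂ) • D.cxMap R hRα) ∧
      Module.End.eigenspace ((D.c : ℂ) • D.cxMap R hRα) Complex.I = D.cxSpan hPα ∧
      Module.End.eigenspace ((D.c : ℂ) • D.cxMap R hRα) (-Complex.I) = D.cxSpan hNα ∧
      LinearMap.toMatrix bc bc ((D.c : ℂ) • D.cxMap R hRα) ∈ O)) :
    ∀ p : ℕ, p.Prime → p % 4 = 3 → 7 ≤ p → ∀ (k : ℕ), 1 ≤ k → ∀ (X : AbelianVariety ℂ) (Φ : X ⟶ X) (hX : X.dim = 2 * k), Φ ≫ Φ = -((p : ℤ) • 𝟙 X) → Module.finrank ℂ ↥(Module.End.eigenspace (complexBetti.map Φ.hom.hom.hom 1).hom (Complex.I * (Real.sqrt p : ℂ)) ⊓ hodgeOneZero (Motives.isSmoothProjective_of_dim_eq' hX)) = k → ∃ (𝒳 S : SchemeOver ℂ) (f : 𝒳 ⟶ S) (g : 𝒳 ⟶ 𝒳) (s₁ s₀ : ComplexPoints S) (e : X.X ≅ fiberOver f s₁), IsSmoothProjectiveFamily f (2 * k) ∧ (∃ (N : ℕ)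 (ι : 𝒳 ⟶ projectiveSpace N ℂ ⊗ S), IsClosedImmersion ι.left ∧ ι ≫ snd (projectiveSpace N ℂ) S = f) ∧ IrreducibleSpace S.left ∧ AlgebraicGeometry.Smooth S.hom ∧ IsQuasiProjectiveOver S ∧ g ≫ f = f ∧ (∀ s : ComplexPoints S, ∃ (A' : AbelianVariety ℂ) (φ' : A' ⟶ A') (e' : A'.X ≅ fiberOver f s), A'.dim = 2 * k ∧ φ' ≫ φ' = -((p : ℤ) • 𝟙 A') ∧ (e'.hom ≫ fiberι f s) ≫ g = φ'.hom.hom.hom ≫ (e'.hom ≫ fiberι f s)) ∧ (e.hom ≫ fiberι f s₁) ≫ g = Φ.hom.hom.hom ≫ (e.hom ≫ fiberι f s₁) ∧ (∃ (ιb : Type) (_ : Fintype ιb) (_ : DecidableEq ιb) (b : Module.Basis ιb ℂ (complexBetti (fiberOver f s₁) 1)) (Jℤ : Matrix ιb ιb ℤ) (n' : ℕ), 3 ≤ n' ∧ (∀ g₁ : fiberOver f s₁ ⟶ fiberOver f s₁, g₁ ≫ fiberι f s₁ = fiberι f s₁ ≫ g → LinearMap.toMatrix b b (complexBetti.map g₁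 1).hom = Jℤ.map (Int.castRingHom ℂ)) ∧ ∀ (hU : IsCohomologicallyLocallyTrivialOn f (Set.univ : Set (ComplexPoints S))) (γ : Path.Homotopic.Quotient (⟨s₁, Set.mem_univ s₁⟩ : (Set.univ : Set (ComplexPoints S))) ⟨s₁, Set.mem_univ s₁⟩), ∃ Dℤ : Matrix ιb ιb ℤ, LinearMap.toMatrix b b (transportLinear f 1 hU γ :) = (1 + (n' : ℤ) • Dℤ).map (Int.castRingHom ℂ)) ∧ ∃ (Y : AbelianVariety ℂ) (Ψ : Y ⟶ Y) (e₀ : Y.X ≅ fiberOver f s₀) (hY : Y.dim = 2 * k), Ψ ≫ Ψ = -((p : ℤ) • 𝟙 Y) ∧ (e₀.hom ≫ fiberι f s₀) ≫ g = Ψ.hom.hom.hom ≫ (e₀.hom ≫ fiberι f s₀) ∧ ∃ Pr : complexBetti Y.X 1 →ₗ[ℂ] complexBetti Y.X 1, IsIdempotentElem Pr ∧ Pr ∘ₗ (complexBetti.map Ψ.hom.hom.hom 1).hom = (complexBetti.map Ψ.hom.hom.hom 1).hom ∘ₗ Pr ∧ (∀ x, IsRationalClass x → IsRationalClass (Pr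 x)) ∧ LinearMap.range Pr ⊓ Module.End.eigenspace (complexBetti.map Ψ.hom.hom.hom 1).hom (Complex.I * (Real.sqrt p : ℂ)) ≤ hodgeZeroOne (Motives.isSmoothProjective_of_dim_eq' hY) ∧ LinearMap.ker Pr ⊓ Module.End.eigenspace (complexBetti.map Ψ.hom.hom.hom 1).hom (Complex.I * (Real.sqrt p : ℂ)) ≤ hodgeOneZero (Motives.isSmoothProjective_of_dim_eq' hY) := by
  intro p hp hp4 hp7 k hk X Φ hX hΦ hbal
  have hL' := hL p hp hp4 hp7 k hk X Φ hX hΦ hbal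
  clear hL
  obtain ⟨𝒳, S, f, g, s₁, e, hfam, hemb, hirr, hsm, hSqp, hg, hfib, he, hlev, hloc⟩ := hL'
  obtain ⟨sStar, Y, Ψ, ε, m, hm, hYm, hp0, hΨ, eY, a, ha, ha0, ω, hω, hω0, ιc, hιc, hιd, bc, O, hYk, hε,
    hO, hO0, hsurj⟩ := hloc
  haveI : FiniteDimensional ℚ (bettiCohomology Y.X 1) := finite_bettiCohomology_one Y
  have hV : Module.finrank ℚ (bettiCohomology Y.X 1) = 4 * k := by
    rw [finrank_bettiCohomology_one, hYk]; ring
  -- a rational diagonal point INSIDE the open set `O`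
  obtain ⟨P, Nn, R, hRα, hPα, hNα, hcpl, hW, hEP, hEN, hmem⟩ :=
    hD _ (weilDatumOfKsymm hm hYm hp0 hΨ eY ha ha0 hω hω0) ιc bc O hO hO0
  clear hD hO0
  -- it is the period point of a fibre `(Y', Ψ') ≅ 𝒳_{s₀}`
  obtain ⟨s₀, Y', Ψ', ε', β, hY', hΨ', hε', hβK, hβH⟩ := hsurj _ hW hmem
  clear hsurj
  have hβH' : ∀ x ∈ HodgeStructure.cxF1 ((weilDatumOfKsymm hm hYm hp0 hΨ eY ha ha0 hω hω0).realJ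
      (((weilDatumOfKsymm hm hYm hp0 hΨ eY ha ha0 hω hω0).c : ℂ) •
        (weilDatumOfKsymm hm hYm hp0 hΨ eY ha ha0 hω hω0).cxMap R hRα)),
      IsOfHodgeType (2 * k) Y'.X 1 1 0
        (Motives.ofRatClassBaseChange (ComplexPoints Y'.X) 1 (β.toLinearMap.baseChange ℂ x)) :=
    fun x hx => hβH x (by rwa [Motives.WeilDatum.piece_one_zero_hodgeStructure])
  clear hβH
  have hβK' : ∀ x, β ((weilDatumOfKsymm hm hYm hp0 hΨ eY ha ha0 hω hω0).α x) =
      bettiCohomology.map Ψ'.hom.hom.hom 1 (β x) := fun x => hβK x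
  clear hβK
  -- the CM projector at `Y'`
  have hι : (weilDatumOfKsymm hm hYm hp0 hΨ eY ha ha0 hω hω0).iSqrt = Complex.I * (Real.sqrt p : ℂ) := by
    rw [Motives.WeilDatum.iSqrt, weilDatumOfKsymm_d, Rat.cast_natCast]
  obtain ⟨Pr, hPr, hPrT, hPrrat, hrange, hker⟩ :=
    cm_projector_of_periodPoint hY' hV (weilDatumOfKsymm hm hYm hp0 hΨ eY ha ha0 hω hω0) hRα hPα hNα hcpl
      hW.sq hEP hEN β Ψ' hβK' hβH'
  rw [hι] at hrange hker
  refine ⟨𝒳, S, f, g, s₁, s₀, e, hfam, hemb, hirr, hsm, hSqp, hg, hfib, he, hlev, ?_⟩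
  refine ⟨Y', Ψ', ε', hY', hΨ', hε', ?_⟩
  exact ⟨Pr, hPr, hPrT, hPrrat, hrange, hker⟩

set_option maxHeartbeats 800000 in
/-- **SANDWICH CERTIFICATE [U] ⟹ [U_loc]**: Deligne's period construction (hypothesis `h` of
`deligne1982_weilFamily_levelStructure_of_periodConstruction`, verbatim; period surjectivity for ALL
`J ∈ X⁺(D_X)`) gives the local Weil family with `s⋆ = s₁`, chart `(X, Φ)` and `O = univ`. So stub 1
is a CONSEQUENCE of Deligne's theorem (true), strictly weaker than [U] as a statement, and
`heckePrymAnchors_of_cmAnchoredFamily ∘ cmAnchoredFamily_of_localWeilFamily ∘ this` re-proves the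
landed `heckePrymAnchors_of_periodConstruction` modulo the density lemma.
[cite: Deligne1982HodgeCycles, proof of Thm. 4.8 (pp. 48–51)] -/
theorem localWeilFamily_of_periodConstruction
    (h : ∀ (n d : ℕ), 1 ≤ n → 1 ≤ d → ∀ (P : AbelianVariety ℂ) (ψ₀ : P ⟶ P) (e : ProjectiveEmbedding P.X) (a : complexBetti (projectiveSpace e.n ℂ) 2), P.dim = 2 * n → ψ₀ ≫ ψ₀ = -((d : ℤ) • 𝟙 P) → ∀ (ha : IsRationalClass a) (ha0 : a ≠ 0), ∃ (𝒳 S : SchemeOver ℂ) (f : 𝒳 ⟶ S) (g : 𝒳 ⟶ 𝒳) (s₀ : ComplexPoints S) (e' : P.X ≅ fiberOver f s₀) (Y : ComplexPoints S → AbelianVariety ℂ) (Ψ : ∀ s, Y s ⟶ Y s) (ε : ∀ s, (Y s).X ≅ fiberOver f s) (N : ℕ) (ι : 𝒳 ⟶ CategoryTheory.MonoidalCategoryStruct.tensorObj (projectiveSpace N ℂ) S), IsSmoothProjectiveFamily f (2 * n) ∧ AlgebraicGeometry.IsClosedImmersion ι.left ∧ ι ≫ CategoryTheory.CartesianMonoidalCategory.snd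 (projectiveSpace N ℂ) S = f ∧ IrreducibleSpace S.left ∧ AlgebraicGeometry.Smooth S.hom ∧ IsQuasiProjectiveOver S ∧ g ≫ f = f ∧ (e'.hom ≫ fiberι f s₀) ≫ g = ψ₀.hom.hom.hom ≫ (e'.hom ≫ fiberι f s₀) ∧ (∀ s, (Y s).dim = 2 * n ∧ Ψ s ≫ Ψ s = -((d : ℤ) • 𝟙 (Y s)) ∧ ((ε s).hom ≫ fiberι f s) ≫ g = (Ψ s).hom.hom.hom ≫ ((ε s).hom ≫ fiberι f s)) ∧ (∃ (ιb : Type) (_ : Fintype ιb) (_ : DecidableEq ιb) (b : Module.Basis ιb ℂ (complexBetti (fiberOver f s₀) 1)) (Jℤ : Matrix ιb ιb ℤ) (n' : ℕ), 3 ≤ n' ∧ (∀ g₀ : fiberOver f s₀ ⟶ fiberOver f s₀, g₀ ≫ fiberι f s₀ = fiberι f s₀ ≫ g → LinearMap.toMatrix b b (complexBetti.map g₀ 1).hom = Jℤ.map (Int.castRingHom ℂ)) ∧ ∀ (hU : IsCohomologicallyLocallyTrivialOn f (Set.univ : Set (ComplexPoints S))) (γ : Path.Homotopic.Quotient (⟨s₀,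 Set.mem_univ s₀⟩ : (Set.univ : Set (ComplexPoints S))) ⟨s₀, Set.mem_univ s₀⟩), ∃ Dℤ : Matrix ιb ιb ℤ, LinearMap.toMatrix b b (transportLinear f 1 hU γ :) = (1 + (n' : ℤ) • Dℤ).map (Int.castRingHom ℂ)) ∧ ∃ (m : ℕ) (hm : 1 ≤ m) (hPm : P.dim = m + 1) (hd : 0 < d) (hψ : ψ₀ ≫ ψ₀ = -(d • 𝟙 P)) (ω : complexBetti P.X (2 + 2 * m)) (hω : IsRationalClass ω) (hω0 : ω ≠ 0), ∀ (J : (weilDatumOfKsymm hm hPm hd hψ e ha ha0 hω hω0).Cx →ₗ[ℂ] (weilDatumOfKsymm hm hPm hd hψ e ha ha0 hω hω0).Cx) (hW : Motives.IsWeilComplexStructure (weilDatumOfKsymm hm hPm hd hψ e ha ha0 hω hω0).hForm J), ∃ (s : ComplexPoints S) (β : bettiCohomology P.X 1 ≃ₗ[ℚ] bettiCohomology (Y s).X 1), (∀ x, β (bettiCohomology.map ψ₀.hom.hom.hom 1 x) = bettiCohomology.map (Ψ s).hom.hom.hom 1 (β x)) ∧ ∀ x ∈ ((weilDatumOfKsymm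 hm hPm hd hψ e ha ha0 hω hω0).hodgeStructure J hW.sq).piece 1 0, IsOfHodgeType (2 * n) (Y s).X 1 1 0 (Motives.ofRatClassBaseChange (ComplexPoints (Y s).X) 1 (β.toLinearMap.baseChange ℂ x))) :
    (∀ p : ℕ, p.Prime → p % 4 = 3 → 7 ≤ p → ∀ (k : ℕ), 1 ≤ k → ∀ (X : AbelianVariety ℂ) (Φ : X ⟶ X)
    (hX : X.dim = 2 * k), Φ ≫ Φ = -((p : ℤ) • 𝟙 X) →
    Module.finrank ℂ ↥(Module.End.eigenspace (complexBetti.map Φ.hom.hom.hom 1).hom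
      (Complex.I * (Real.sqrt p : ℂ)) ⊓ hodgeOneZero (Motives.isSmoothProjective_of_dim_eq' hX)) = k →
    ∃ (𝒳 S : SchemeOver ℂ) (f : 𝒳 ⟶ S) (g : 𝒳 ⟶ 𝒳) (s₁ : ComplexPoints S) (e : X.X ≅ fiberOver f s₁),
      IsSmoothProjectiveFamily f (2 * k) ∧
      (∃ (N : ℕ) (ι : 𝒳 ⟶ projectiveSpace N ℂ ⊗ S), IsClosedImmersion ι.left ∧ ι ≫ snd (projectiveSpace N ℂ) S = f) ∧
      IrreducibleSpace S.left ∧ AlgebraicGeometry.Smooth S.hom ∧ IsQuasiProjectiveOver S ∧ g ≫ f = f ∧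
      (∀ s : ComplexPoints S, ∃ (A' : AbelianVariety ℂ) (φ' : A' ⟶ A') (e' : A'.X ≅ fiberOver f s),
        A'.dim = 2 * k ∧ φ' ≫ φ' = -((p : ℤ) • 𝟙 A') ∧
        (e'.hom ≫ fiberι f s) ≫ g = φ'.hom.hom.hom ≫ (e'.hom ≫ fiberι f s)) ∧
      (e.hom ≫ fiberι f s₁) ≫ g = Φ.hom.hom.hom ≫ (e.hom ≫ fiberι f s₁) ∧
      (∃ (ιb : Type) (_ : Fintype ιb) (_ : DecidableEq ιb) (b : Module.Basis ιb ℂ (complexBetti (fiberOver f s₁) 1))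
          (Jℤ : Matrix ιb ιb ℤ) (n' : ℕ), 3 ≤ n' ∧
        (∀ g₁ : fiberOver f s₁ ⟶ fiberOver f s₁, g₁ ≫ fiberι f s₁ = fiberι f s₁ ≫ g →
          LinearMap.toMatrix b b (complexBetti.map g₁ 1).hom = Jℤ.map (Int.castRingHom ℂ)) ∧
        ∀ (hU : IsCohomologicallyLocallyTrivialOn f (Set.univ : Set (ComplexPoints S)))
          (γ : Path.Homotopic.Quotient (⟨s₁, Set.mem_univ s₁⟩ : (Set.univ : Set (ComplexPoints S))) ⟨s₁, Set.mem_univ s₁⟩),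
          ∃ Dℤ : Matrix ιb ιb ℤ, LinearMap.toMatrix b b (transportLinear f 1 hU γ :) = (1 + (n' : ℤ) • Dℤ).map (Int.castRingHom ℂ)) ∧
      ∃ (sStar : ComplexPoints S) (Y : AbelianVariety ℂ) (Ψ : Y ⟶ Y) (ε : Y.X ≅ fiberOver f sStar)
        (m : ℕ) (hm : 1 ≤ m) (hYm : Y.dim = m + 1) (hp0 : 0 < p) (hΨ : Ψ ≫ Ψ = -(p • 𝟙 Y))
        (eY : ProjectiveEmbedding Y.X) (a : complexBetti (projectiveSpace eY.n ℂ) 2)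
        (ha : IsRationalClass a) (ha0 : a ≠ 0) (ω : complexBetti Y.X (2 + 2 * m)) (hω : IsRationalClass ω) (hω0 : ω ≠ 0)
        (ιc : Type) (_ : Fintype ιc) (_ : DecidableEq ιc)
        (bc : Module.Basis ιc ℂ (weilDatumOfKsymm hm hYm hp0 hΨ eY ha ha0 hω hω0).Cx)
        (O : Set (Matrix ιc ιc ℂ)),
        Y.dim = 2 * k ∧ (ε.hom ≫ fiberι f sStar) ≫ g = Ψ.hom.hom.hom ≫ (ε.hom ≫ fiberι f sStar) ∧ IsOpen O ∧
        (∃ J₀ : (weilDatumOfKsymm hm hYm hp0 hΨ eY ha ha0 hω hω0).Cx →ₗ[ℂ] (weilDatumOfKsymm hm hYm hp0 hΨ eY ha ha0 hω hω0).Cx,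
          Motives.IsWeilComplexStructure (weilDatumOfKsymm hm hYm hp0 hΨ eY ha ha0 hω hω0).hForm J₀ ∧
          LinearMap.toMatrix bc bc J₀ ∈ O) ∧
        ∀ (J : (weilDatumOfKsymm hm hYm hp0 hΨ eY ha ha0 hω hω0).Cx →ₗ[ℂ] (weilDatumOfKsymm hm hYm hp0 hΨ eY ha ha0 hω hω0).Cx)
          (hW : Motives.IsWeilComplexStructure (weilDatumOfKsymm hm hYm hp0 hΨ eY ha ha0 hω hω0).hForm J),
          LinearMap.toMatrix bc bc J ∈ O →
          ∃ (s : ComplexPoints S) (Y' : AbelianVariety ℂ) (Ψ' : Y' ⟶ Y') (ε' : Y'.X ≅ fiberOver f s)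
            (β : bettiCohomology Y.X 1 ≃ₗ[ℚ] bettiCohomology Y'.X 1),
            Y'.dim = 2 * k ∧ Ψ' ≫ Ψ' = -((p : ℤ) • 𝟙 Y') ∧
            (ε'.hom ≫ fiberι f s) ≫ g = Ψ'.hom.hom.hom ≫ (ε'.hom ≫ fiberι f s) ∧
            (∀ x, β (bettiCohomology.map Ψ.hom.hom.hom 1 x) = bettiCohomology.map Ψ'.hom.hom.hom 1 (β x)) ∧
            ∀ x ∈ ((weilDatumOfKsymm hm hYm hp0 hΨ eY ha ha0 hω hω0).hodgeStructure J hW.sq).piece 1 0,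
              IsOfHodgeType (2 * k) Y'.X 1 1 0
                (Motives.ofRatClassBaseChange (ComplexPoints Y'.X) 1 (β.toLinearMap.baseChange ℂ x))) := by
  intro p hp hp4 hp7 k hk X Φ hX hΦ _hbal
  have hp0 : 0 < p := hp.pos
  have hXsp : IsSmoothProjective (2 * k) X.X := Motives.isSmoothProjective_of_dim_eq' hX
  let eX : ProjectiveEmbedding X.X := hXsp.isProjectiveOver.projectiveEmbedding
  have hNX : 1 ≤ eX.n := le_trans (by omega) (le_of_isClosedImmersion_projectiveSpace hXsp eX.ι)
  obtain ⟨a, ha, ha0⟩ := exists_isRationalClass_ne_zero_projectiveSpace hNX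
  obtain ⟨𝒳, S, f, g, s₁, e, Yf, Ψf, ε, N, ι, hfam, hιci, hιf, hirr, hsm, hSqp, hg, he, hfib, hlev, hU⟩ :=
    h k p hk hp0 X Φ eX a hX hΦ ha ha0
  clear h
  obtain ⟨m, hm, hXm, hd, hΦ', ω, hω, hω0, hsurj⟩ := hU
  haveI : FiniteDimensional ℚ (bettiCohomology X.X 1) := finite_bettiCohomology_one X
  obtain ⟨⟨J₀, hJ₀⟩⟩ := (weilDatumOfKsymm hm hXm hd hΦ' eX ha ha0 hω hω0).nonempty_weilComplexStructure
  refine ⟨𝒳, S, f, g, s₁, e, hfam, ⟨N, ι, hιci, hιf⟩, hirr, hsm, hSqp, hg,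
    fun t => ⟨Yf t, Ψf t, ε t, (hfib t).1, (hfib t).2.1, (hfib t).2.2⟩, he, hlev, ?_⟩
  refine ⟨s₁, X, Φ, e, m, hm, hXm, hd, hΦ', eX, a, ha, ha0, ω, hω, hω0, _, inferInstance, inferInstance,
    Module.finBasis ℂ (weilDatumOfKsymm hm hXm hd hΦ' eX ha ha0 hω hω0).Cx, Set.univ, hX, he, isOpen_univ,
    ⟨J₀, hJ₀, Set.mem_univ _⟩, ?_⟩
  intro J hW _
  obtain ⟨s, β, hβK, hβH⟩ := hsurj J hW
  exact ⟨s, Yf s, Ψf s, ε s, β, (hfib s).1, (hfib s).2.1, (hfib s).2.2, hβK, hβH⟩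

/-- **The line closes the crux**: `HeckePrymAnchors` BY NAME from the two stubs, through the landed
period-free residual `heckePrymAnchors_of_cmAnchoredFamily` (p144675). -/
theorem HeckePrymAnchors_of : HeckePrymAnchors :=
  heckePrymAnchors_of_cmAnchoredFamily
    (cmAnchoredFamily_of_localWeilFamily stub_localWeilFamily stub_rationalDiagonalDense)

end Summit.HodgeConjecture.HodgeConjecture.Cruxes.HeckePrymAnchors.JacobianHodgeLocus

end
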